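import Literature.MathematicalPhysics.QuantumFieldTheory.Balaban1983to89.B6RandomWalkL2Chain
import Literature.MathematicalPhysics.QuantumFieldTheory.Balaban1983to89.B6RandomWalkHom

/-!
# `Balaban1983to89.B6RandomWalkL2ChainLeft` — T. Bałaban, *Propagators and renormalization transformations for lattice gauge theories. II*,
# Commun. Math. Phys. **96** (1984) 223–250 [`Balaban1984PropagatorsII`], (2.64)–(2.66) p. 234 and (2.141) p. 247 IN THE `L²` NORMS, FOR A
# LEFT FIXED POINT `Y = Y₀ + MY` (the right entries of [B9] Theorem 3.1 (3.46) for `G′(U′U)`, p. 403 l. 1–9, by the first form of (3.65)):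
# the terms `MⁿY₀`, the partial sums, the fixed point, and the p. 398 weight convention in `L²` (sequel of p22's `…B6RandomWalkL2Chain`,
# which treats the RIGHT fixed point `G = G₀ + GR`)

statement-level skeleton of published theorems with citation tags; proofs where landed; nothing here is a claim about the Yang–Mills mass gap

WHAT IS PRINTED.  [4] p. 234: *"Applying this inequality to the n^th power of the operator R in (2.38) we have |(Rⁿλ)(x)| ≤ (O(M^{−1})c₁)ⁿ
e^{−½δ₀d(y,y′)}|λ|, (2.65) … |(G′λ)(x)| ≤ Σ_{n=0}^∞ |(G′₀Rⁿλ)(x)| ≤ … (2.66)"*; p. 247: *"the series above is convergent in the norms appearing in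
the inequalities (2.136)–(2.140)"*.  [B9] = T. Bałaban, *Propagators for lattice gauge theories in a background field*, Commun. Math. Phys. **99**
(1985) 389–434 [`Balaban1985BackgroundPropagators`], p. 403 l. 1–9: *"applying Theorem 3.1 for G′(U), the bound (3.63), the representation (3.64)
and Lemma 2.1 of [4] we can prove all the statements (3.42)–(3.47) of Theorem 3.1 for the operator G′(U′U)"*; p. 398 (after (3.47)): *"Using
Lemma 2.1 in [4] we may replace the factor (Lʲη)^α by (Lʲη)^β(L^{j′}η)^γ with β + γ = α"*.

WHY THIS FILE (pub-ymgap N06 row 13, the ℓ²-block Sect.-B route).  p22's `B6RandomWalkL2Chain.l2Majorant_of_fixedPoint_266` sums the walk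
`G′ = G′₀ + G′R` (fixed point multiplied on the RIGHT) — enough for the LEFT entries `X·G′(U′U)` of (3.46) via the second form of (3.65)
(`B9Ineq363L2.hasL2Majorant_leftEntry_gpExt`).  The RIGHT entries `G′(U′U)∇*`, `∇G′(U′U)∇*` need the first form `G′(U′U) = G′(U) +
G′(U)V′(A)G′(U′U)`, i.e. a fixed point multiplied on the LEFT, `Y = Y₀ + MY`, whose series `Σ_n MⁿY₀` carries Theorem 3.1's power of `Lʲη` at
the intermediate block; this file sums that series in the block-`ℓ²` majorants with the weight parked at the INPUT block and moves it back
to the output block by the p. 398 convention (pv21's sup-norm `B6RandomWalkHom.b9_rightEntry_outputWeight_365`, read in `L²`).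

WHAT IS IN THE FILE (theorems only; 0 sorry; standard axioms; p22's `l2Majorant_pow_265`, `hasL2Majorant_mul`, `hasL2Majorant_sum`,
`exists_l2OpBound` and pv08's kernel algebra `Ineq261`∕`Ineq263`∕`Triangle254`∕`c1` BY NAME):
§1 (the left telescope `Y = Σ_{n<N}MⁿY₀ + M^N Y` is pv21's `B6RandomWalkHom.leftFixedPoint_telescope`, BY NAME) `kernel_conv_G0_le_left` (the kernel step of (2.66) with the weight at the input
block; needs the symmetry of `d`); `l2Majorant_pow_mul_G0_265` (`MⁿY₀ ≺₂ Ac₁(θc₁)ⁿP(y′)e^{−(1−α)δ₀d}`); `l2Majorant_partialSum_266_left`;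
★ `l2Majorant_of_leftFixedPoint_266` (`Y = Y₀ + MY`, `Y₀ ≺₂ AP(y′)e^{−δ₀d}`, `M ≺₂ θe^{−δ₀d}`, `θc₁ < 1` ⟹ `Y ≺₂ Ac₁(1 − θc₁)⁻¹P(y′)e^{−(1−α)δ₀d}`;
the remainder `M^N Y → 0` through the trivial block majorant of `Y` by its global `ℓ²` bound).
§2 `hasL2Majorant_weight_to_input` ∕ `hasL2Majorant_weight_to_output` (p. 398 convention in `L²`), `hasL2Majorant_rate_mono'`.
§3 ★★ `l2Majorant_rightEntry_of_leftFixedPoint` — POWERS AT THE OUTPUT BLOCK AS PRINTED: `Y₀ ≺₂ B·P(y)·e^{−δ₀d}`, `M ≺₂ θe^{−δ₀d}`, two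
transfers (`Λ` at `α′δ₀`, `Λ′` at `α″δ₂`), (2.61) at `(δ₁, α)` ((2.63) follows, pv08's `ineq263_of_261`; `δ₁ = (1−α′)δ₀`, `δ₂ = (1−α)δ₁`), `θc₁(δ₁,α) < 1` ⟹
`Y ≺₂ BΛc₁(1 − θc₁)⁻¹Λ′·P(y)·e^{−(1−α″)δ₂d}`.

HONEST SCOPE ∕ DIVERGENCES.  (1) As p22's file: the block-`ℓ²` majorants of `Y₀` and `M` are hypotheses OF THE PRINTED SHAPE (for [B9]: Theorem 3.1's
(3.46)₂ at U and the `L²` (3.63)-type bound of `G′(U)V′(A)`, the latter a successor item); the transfers are p. 398's convention as hypotheses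
(`B9Ineq347.ScaleTransfer` unfolded, both orientations).  (2) Unweighted `ℓ²` sums; sharp block cut-offs.  (3) Bookkeeping toward the right
entries of (3.46) for `G′(U′U)` — NOT those entries, NOT a node discharge, nothing continuum ∕ OS ∕ mass-gap ∕ Clay.  Cell `pub-ymgap` (HUMAN RULING
D-0062), Track A node N06 [B9], N06-ASSIGNMENT row 13, seat `pub-ymgap-dag-n06-c` (g4), 2026-08-27.
-/

noncomputable section

open scoped BigOperators
open Finset

namespace Literature.MathematicalPhysics.QuantumFieldTheory.Balaban1983to89.B6RandomWalkL2ChainLeft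

open B6RandomWalk (blockPiece sum_blockPiece chain chain_const_mul Ineq261 Ineq263 Triangle254 c1_nonneg)
open B6RandomWalkL2 (l2n l2n_nonneg l2n_zero l2n_add_le l2n_sum_le l2n_blockPiece_le blockPiece_add HasL2Majorant
  hasL2Majorant_mono hasL2Majorant_add hasL2Majorant_sum hasL2Majorant_mul exists_l2OpBound)
open B6RandomWalkL2Chain (l2Majorant_pow_265)
open B6RandomWalkHom (leftFixedPoint_telescope)

variable {g : B6.Geometry} {X : Type} [Fintype X]

/-! ## §1  The kernel step with the weight at the input block, the terms, the partial sums, the left fixed point -/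

section LeftChain

variable (blk : X → g.Site)

/-- the KERNEL step of (2.66) with the weight carried by the INPUT block (mirror image of `B6RandomWalkL2Chain.kernel_G0_conv_le`):
`Σ_{y″} (r·e^{−(1−α)δ₀d(a,y″)})·(A·P(b)·e^{−δ₀d(y″,b)}) ≤ A·c₁·r·P(b)·e^{−(1−α)δ₀d(a,b)}` — split `e^{−δ₀d(y″,b)} =
e^{−(1−α)δ₀d(y″,b)}e^{−αδ₀d(y″,b)}`, pull `e^{−(1−α)δ₀d(a,b)}` out by (2.54), and sum `e^{−αδ₀d(b,·)}` by (2.61) (symmetry of `d`).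
[cite: Balaban1984PropagatorsII, (2.66) p.234 with (2.54) p.233, (2.61) p.234] -/
theorem kernel_conv_G0_le_left (d : ℕ) (δ₀ α A r : ℝ) (P : g.Site → ℝ) (hA : 0 ≤ A) (hP : ∀ y, 0 ≤ P y) (hr : 0 ≤ r)
    (hαδ : 0 ≤ (1 - α) * δ₀) (htri : Triangle254 g) (hsym : ∀ y y' : g.Site, g.dist y y' = g.dist y' y)
    (h261 : Ineq261 d g δ₀ α) (a b : g.Site) :
    ∑ y'' : g.Site, r * Real.exp (-((1 - α) * δ₀ * g.dist a y'')) * (A * P b * Real.exp (-(δ₀ * g.dist y'' b))) ≤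
      A * B6.c1 d δ₀ α * r * P b * Real.exp (-((1 - α) * δ₀ * g.dist a b)) := by
  have h0 : 0 ≤ A * r * P b := mul_nonneg (mul_nonneg hA hr) (hP b)
  have hterm : ∀ y'' : g.Site,
      r * Real.exp (-((1 - α) * δ₀ * g.dist a y'')) * (A * P b * Real.exp (-(δ₀ * g.dist y'' b))) ≤
        A * r * P b * Real.exp (-((1 - α) * δ₀ * g.dist a b)) * Real.exp (-(α * δ₀ * g.dist b y'')) := by
    intro y''
    have hexp : Real.exp (-((1 - α) * δ₀ * g.dist a y'')) * Real.exp (-(δ₀ * g.dist y'' b)) ≤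
        Real.exp (-((1 - α) * δ₀ * g.dist a b)) * Real.exp (-(α * δ₀ * g.dist b y'')) := by
      rw [← Real.exp_add, ← Real.exp_add]
      refine Real.exp_le_exp.mpr ?_
      have := mul_le_mul_of_nonneg_left (htri a y'' b) hαδ
      rw [hsym b y'']
      nlinarith
    calc r * Real.exp (-((1 - α) * δ₀ * g.dist a y'')) * (A * P b * Real.exp (-(δ₀ * g.dist y'' b)))
        = A * r * P b * (Real.exp (-((1 - α) * δ₀ * g.dist a y'')) * Real.exp (-(δ₀ * g.dist y'' b))) := by ring
      _ ≤ A * r * P b * (Real.exp (-((1 - α) * δ₀ * g.dist a b)) * Real.exp (-(α * δ₀ * g.dist b y''))) :=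
          mul_le_mul_of_nonneg_left hexp h0
      _ = _ := by ring
  calc ∑ y'' : g.Site, r * Real.exp (-((1 - α) * δ₀ * g.dist a y'')) * (A * P b * Real.exp (-(δ₀ * g.dist y'' b)))
      ≤ ∑ y'' : g.Site, A * r * P b * Real.exp (-((1 - α) * δ₀ * g.dist a b)) *
          Real.exp (-(α * δ₀ * g.dist b y'')) := Finset.sum_le_sum fun y'' _ => hterm y''
    _ = A * r * P b * Real.exp (-((1 - α) * δ₀ * g.dist a b)) *
          ∑ y'' : g.Site, Real.exp (-(α * δ₀ * g.dist b y'')) := by rw [Finset.mul_sum]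
    _ ≤ A * r * P b * Real.exp (-((1 - α) * δ₀ * g.dist a b)) * B6.c1 d δ₀ α :=
        mul_le_mul_of_nonneg_left (h261 b) (mul_nonneg h0 (Real.exp_nonneg _))
    _ = A * B6.c1 d δ₀ α * r * P b * Real.exp (-((1 - α) * δ₀ * g.dist a b)) := by ring

/-- **One term of the left-routed series IN `L²`**: `MⁿY₀` with the `M`-majorant `θe^{−δ₀d}` ((2.64)) and the `Y₀`-majorant `A·P(y′)·e^{−δ₀d}`
(weight at the INPUT block) has the block-`ℓ²` majorant `A c₁(α)(θc₁(α))ⁿ P(y′) e^{−(1−α)δ₀d(y,y′)}` — (2.65) for `Mⁿ`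
(`B6RandomWalkL2Chain.l2Majorant_pow_265` BY NAME), composition (2.52)∕(2.55)ₐ in `L²`, and the mirrored kernel step.
[cite: Balaban1984PropagatorsII, (2.64)–(2.66) p.234, (2.141) p.247] -/
theorem l2Majorant_pow_mul_G0_265 (d : ℕ) (δ₀ α θ A : ℝ) (P : g.Site → ℝ) (hA : 0 ≤ A) (hP : ∀ y, 0 ≤ P y)
    (hθ : 0 ≤ θ) (hαδ : 0 ≤ (1 - α) * δ₀) (htri : Triangle254 g) (hrefl : ∀ y : g.Site, g.dist y y = 0)
    (hsym : ∀ y y' : g.Site, g.dist y y' = g.dist y' y) (h261 : Ineq261 d g δ₀ α) (h263 : Ineq263 d g δ₀ α)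
    {Y0 M : Module.End ℝ (X → ℝ)}
    (hY0 : HasL2Majorant blk Y0 (fun a b => A * P b * Real.exp (-(δ₀ * g.dist a b))))
    (hM : HasL2Majorant blk M (fun a b => θ * Real.exp (-(δ₀ * g.dist a b)))) (n : ℕ) :
    HasL2Majorant blk (M ^ n * Y0)
      (fun a b => A * B6.c1 d δ₀ α * (θ * B6.c1 d δ₀ α) ^ n * P b * Real.exp (-((1 - α) * δ₀ * g.dist a b))) := by
  have hq0 : 0 ≤ θ * B6.c1 d δ₀ α := mul_nonneg hθ (c1_nonneg d δ₀ α)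
  have hMn := l2Majorant_pow_265 blk d δ₀ α θ hθ hrefl h263 hM n
  have hK : ∀ a b : g.Site, 0 ≤ (θ * B6.c1 d δ₀ α) ^ n * Real.exp (-((1 - α) * δ₀ * g.dist a b)) := fun a b =>
    mul_nonneg (pow_nonneg hq0 n) (Real.exp_nonneg _)
  exact hasL2Majorant_mono blk (hasL2Majorant_mul blk hMn hY0 hK)
    (fun a b => kernel_conv_G0_le_left d δ₀ α A ((θ * B6.c1 d δ₀ α) ^ n) P hA hP (pow_nonneg hq0 n) hαδ htri hsym
      h261 a b)

/-- **(2.66) IN `L²` for the left-routed series, the partial sums**: every `Σ_{n<N} MⁿY₀` has the block-`ℓ²` majorant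
`A c₁(α)(1 − θc₁(α))⁻¹ P(y′) e^{−(1−α)δ₀d(y,y′)}`, UNIFORMLY in `N`, under the located smallness `θc₁(α) < 1`.
[cite: Balaban1984PropagatorsII, (2.66) p.234, (2.141) p.247] -/
theorem l2Majorant_partialSum_266_left (d : ℕ) (δ₀ α θ A : ℝ) (P : g.Site → ℝ) (hA : 0 ≤ A)
    (hP : ∀ y, 0 ≤ P y) (hθ : 0 ≤ θ) (hαδ : 0 ≤ (1 - α) * δ₀) (htri : Triangle254 g)
    (hrefl : ∀ y : g.Site, g.dist y y = 0) (hsym : ∀ y y' : g.Site, g.dist y y' = g.dist y' y)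
    (h261 : Ineq261 d g δ₀ α) (h263 : Ineq263 d g δ₀ α)
    (hsmall : θ * B6.c1 d δ₀ α < 1) {Y0 M : Module.End ℝ (X → ℝ)}
    (hY0 : HasL2Majorant blk Y0 (fun a b => A * P b * Real.exp (-(δ₀ * g.dist a b))))
    (hM : HasL2Majorant blk M (fun a b => θ * Real.exp (-(δ₀ * g.dist a b)))) (N : ℕ) :
    HasL2Majorant blk (∑ n ∈ Finset.range N, M ^ n * Y0)
      (fun a b => A * B6.c1 d δ₀ α * (1 - θ * B6.c1 d δ₀ α)⁻¹ * P b *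
        Real.exp (-((1 - α) * δ₀ * g.dist a b))) := by
  set q : ℝ := θ * B6.c1 d δ₀ α with hq
  have hq0 : 0 ≤ q := mul_nonneg hθ (c1_nonneg d δ₀ α)
  have hterm : ∀ n, HasL2Majorant blk (M ^ n * Y0)
      (fun a b => A * B6.c1 d δ₀ α * q ^ n * P b * Real.exp (-((1 - α) * δ₀ * g.dist a b))) := fun n =>
    l2Majorant_pow_mul_G0_265 blk d δ₀ α θ A P hA hP hθ hαδ htri hrefl hsym h261 h263 hY0 hM n
  refine hasL2Majorant_mono blk (hasL2Majorant_sum blk (fun n => M ^ n * Y0) _ hterm N) fun a b => ?_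
  have hgeom : ∑ n ∈ Finset.range N, q ^ n ≤ (1 - q)⁻¹ :=
    sum_le_hasSum (Finset.range N) (fun n _ => pow_nonneg hq0 n) (hasSum_geometric_of_lt_one hq0 hsmall)
  have hC : 0 ≤ A * B6.c1 d δ₀ α * P b * Real.exp (-((1 - α) * δ₀ * g.dist a b)) :=
    mul_nonneg (mul_nonneg (mul_nonneg hA (c1_nonneg d δ₀ α)) (hP b)) (Real.exp_nonneg _)
  calc ∑ n ∈ Finset.range N, A * B6.c1 d δ₀ α * q ^ n * P b * Real.exp (-((1 - α) * δ₀ * g.dist a b))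
      = A * B6.c1 d δ₀ α * P b * Real.exp (-((1 - α) * δ₀ * g.dist a b)) * ∑ n ∈ Finset.range N, q ^ n := by
        rw [Finset.mul_sum]; refine Finset.sum_congr rfl fun n _ => ?_; ring
    _ ≤ A * B6.c1 d δ₀ α * P b * Real.exp (-((1 - α) * δ₀ * g.dist a b)) * (1 - q)⁻¹ :=
        mul_le_mul_of_nonneg_left hgeom hC
    _ = _ := by ring

/-- **(2.66) ⇒ the operator itself, IN `L²`, for a LEFT fixed point**: every `Y` on the finite lattice with `Y = Y₀ + MY` — the right entries
`Y = G′(U′U)∇*` from the first form of (3.65), `G′(U′U) = G′(U) + G′(U)V′(A)G′(U′U)`, or `G = G₀ + RG`-type representations — has the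
block-`ℓ²` majorant `A c₁(α)(1 − θc₁(α))⁻¹ P(y′) e^{−(1−α)δ₀d(y,y′)}` when `Y₀ ≺₂ A·P(y′)·e^{−δ₀d}` (weight at the INPUT block) and
`M ≺₂ θe^{−δ₀d}` with `θc₁(α) < 1`: the remainder `M^N Y` dies as `N → ∞` by (2.65) in `L²` and the `ℓ²`-boundedness of `Y`
(*"the series above is convergent in the norms appearing in the inequalities (2.136)–(2.140)"*; mirror image of
`B6RandomWalkL2Chain.l2Majorant_of_fixedPoint_266`). [cite: Balaban1984PropagatorsII, (2.66) p.234, (2.141) p.247; Balaban1985BackgroundPropagators, (3.64)–(3.65) pp.402–403] -/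
theorem l2Majorant_of_leftFixedPoint_266 [DecidableEq X] (d : ℕ) (δ₀ α θ A : ℝ) (P : g.Site → ℝ)
    (hA : 0 ≤ A) (hP : ∀ y, 0 ≤ P y) (hθ : 0 ≤ θ) (hαδ : 0 ≤ (1 - α) * δ₀) (htri : Triangle254 g)
    (hrefl : ∀ y : g.Site, g.dist y y = 0) (hsym : ∀ y y' : g.Site, g.dist y y' = g.dist y' y)
    (hdnn : ∀ y y' : g.Site, 0 ≤ g.dist y y')
    (h261 : Ineq261 d g δ₀ α) (h263 : Ineq263 d g δ₀ α) (hsmall : θ * B6.c1 d δ₀ α < 1)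
    {Y Y0 M : Module.End ℝ (X → ℝ)}
    (hY0 : HasL2Majorant blk Y0 (fun a b => A * P b * Real.exp (-(δ₀ * g.dist a b))))
    (hM : HasL2Majorant blk M (fun a b => θ * Real.exp (-(δ₀ * g.dist a b)))) (hfix : Y = Y0 + M * Y) :
    HasL2Majorant blk Y
      (fun a b => A * B6.c1 d δ₀ α * (1 - θ * B6.c1 d δ₀ α)⁻¹ * P b *
        Real.exp (-((1 - α) * δ₀ * g.dist a b))) := by
  intro y y' u hu
  obtain ⟨E, hE, hEb⟩ := exists_l2OpBound Y
  set q : ℝ := θ * B6.c1 d δ₀ α with hq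
  have hq0 : 0 ≤ q := mul_nonneg hθ (c1_nonneg d δ₀ α)
  set C : ℝ := A * B6.c1 d δ₀ α * (1 - q)⁻¹ * P y' * Real.exp (-((1 - α) * δ₀ * g.dist y y')) * l2n u with hC
  set S : ℝ := (Fintype.card g.Site : ℝ) with hS
  -- the trivial block majorant of `Y` by its global `ℓ²` bound
  have hYE : HasL2Majorant blk Y (fun _ _ => E) := fun a b v _ => (l2n_blockPiece_le blk a (Y v)).trans (hEb v)
  -- for every N: ‖Δ(y)Yu‖ ≤ C + S·E·‖u‖·q^N
  have hN : ∀ N : ℕ, l2n (blockPiece blk y (Y u)) ≤ C + S * E * l2n u * q ^ N := by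
    intro N
    have hSum := l2Majorant_partialSum_266_left blk d δ₀ α θ A P hA hP hθ hαδ htri hrefl hsym h261 h263 hsmall hY0 hM N
      y y' u hu
    have hMN := l2Majorant_pow_265 blk d δ₀ α θ hθ hrefl h263 hM N
    have hK : ∀ a b : g.Site, 0 ≤ (θ * B6.c1 d δ₀ α) ^ N * Real.exp (-((1 - α) * δ₀ * g.dist a b)) := fun a b =>
      mul_nonneg (pow_nonneg hq0 N) (Real.exp_nonneg _)
    have hrem := hasL2Majorant_mul blk hMN hYE hK y y' u hu
    have hglob : (∑ z : g.Site, (θ * B6.c1 d δ₀ α) ^ N * Real.exp (-((1 - α) * δ₀ * g.dist y z)) * E) ≤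
        S * E * q ^ N := by
      calc (∑ z : g.Site, (θ * B6.c1 d δ₀ α) ^ N * Real.exp (-((1 - α) * δ₀ * g.dist y z)) * E)
          ≤ ∑ _z : g.Site, q ^ N * E := Finset.sum_le_sum fun z _ => by
            have h1 : Real.exp (-((1 - α) * δ₀ * g.dist y z)) ≤ 1 := by
              rw [Real.exp_le_one_iff]
              have := mul_nonneg hαδ (hdnn y z)
              linarith
            have := mul_le_mul_of_nonneg_left h1 (pow_nonneg hq0 N)
            calc (θ * B6.c1 d δ₀ α) ^ N * Real.exp (-((1 - α) * δ₀ * g.dist y z)) * E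
                ≤ q ^ N * 1 * E := by rw [← hq]; exact mul_le_mul_of_nonneg_right this hE
              _ = q ^ N * E := by ring
        _ = S * E * q ^ N := by rw [Finset.sum_const, Finset.card_univ, nsmul_eq_mul, hS]; ring
    have hsplit : blockPiece blk y (Y u) =
        blockPiece blk y ((∑ n ∈ Finset.range N, M ^ n * Y0) u) + blockPiece blk y ((M ^ N * Y) u) := by
      conv_lhs => rw [leftFixedPoint_telescope hfix N]
      rw [LinearMap.add_apply, blockPiece_add]
    rw [hsplit]
    refine (l2n_add_le _ _).trans ?_
    have h1 : l2n (blockPiece blk y ((∑ n ∈ Finset.range N, M ^ n * Y0) u)) ≤ C := by simpa [hC, hq] using hSum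
    have h2 : l2n (blockPiece blk y ((M ^ N * Y) u)) ≤ S * E * q ^ N * l2n u :=
      hrem.trans (mul_le_mul_of_nonneg_right hglob (l2n_nonneg u))
    nlinarith [h1, h2]
  -- let N → ∞
  have hlim : Filter.Tendsto (fun N : ℕ => C + S * E * l2n u * q ^ N) Filter.atTop (nhds (C + S * E * l2n u * 0)) :=
    ((tendsto_pow_atTop_nhds_zero_of_lt_one hq0 hsmall).const_mul (S * E * l2n u)).const_add C
  rw [mul_zero, add_zero] at hlim
  have := ge_of_tendsto' hlim hN
  simpa [hC, hq] using this

/-! ## §2  Moving the weight between the output and the input block (the p. 398 convention, in `L²`) -/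

/-- **Weight to the INPUT block**: `T ≺₂ A·P(y)·e^{−rd}` and the scale transfer `e^{−α′rd(y,y′)}P(y) ≤ Λ·P(y′)` give
`T ≺₂ AΛ·P(y′)·e^{−(1−α′)rd}` (*"we may replace the factor (Lʲη)^α by (Lʲη)^β(L^{j′}η)^γ"*, p. 398, read in `L²`).
[cite: Balaban1985BackgroundPropagators, p.398 remark after (3.47); Balaban1984PropagatorsII, Lemma 2.1 p.234] -/
theorem hasL2Majorant_weight_to_input (A r α' Λ : ℝ) (P : g.Site → ℝ) (hA : 0 ≤ A)
    (htr : ∀ a b : g.Site, Real.exp (-(α' * r * g.dist a b)) * P a ≤ Λ * P b) {T : Module.End ℝ (X → ℝ)}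
    (h : HasL2Majorant blk T (fun a b => A * P a * Real.exp (-(r * g.dist a b)))) :
    HasL2Majorant blk T (fun a b => A * Λ * P b * Real.exp (-((1 - α') * r * g.dist a b))) := by
  refine hasL2Majorant_mono blk h fun a b => ?_
  have e : Real.exp (-(r * g.dist a b)) =
      Real.exp (-(α' * r * g.dist a b)) * Real.exp (-((1 - α') * r * g.dist a b)) := by
    rw [← Real.exp_add]; congr 1; ring
  rw [e]
  have hE : 0 ≤ Real.exp (-((1 - α') * r * g.dist a b)) := Real.exp_nonneg _
  calc A * P a * (Real.exp (-(α' * r * g.dist a b)) * Real.exp (-((1 - α') * r * g.dist a b)))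
      = A * (Real.exp (-(α' * r * g.dist a b)) * P a) * Real.exp (-((1 - α') * r * g.dist a b)) := by ring
    _ ≤ A * (Λ * P b) * Real.exp (-((1 - α') * r * g.dist a b)) :=
        mul_le_mul_of_nonneg_right (mul_le_mul_of_nonneg_left (htr a b) hA) hE
    _ = _ := by ring

/-- **Weight to the OUTPUT block** («powers at the output block as printed», (3.46): `B₀[(Lʲη)², Lʲη, …]` with `y ∈ Λ_j` the block of `h`):
`T ≺₂ A·P(y′)·e^{−rd}` and the scale transfer `e^{−α′rd(y,y′)}P(y′) ≤ Λ·P(y)` give `T ≺₂ AΛ·P(y)·e^{−(1−α′)rd}`.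
[cite: Balaban1985BackgroundPropagators, (3.46) p.398 + p.398 remark after (3.47); Balaban1984PropagatorsII, Lemma 2.1 p.234] -/
theorem hasL2Majorant_weight_to_output (A r α' Λ : ℝ) (P : g.Site → ℝ) (hA : 0 ≤ A)
    (htr : ∀ a b : g.Site, Real.exp (-(α' * r * g.dist a b)) * P b ≤ Λ * P a) {T : Module.End ℝ (X → ℝ)}
    (h : HasL2Majorant blk T (fun a b => A * P b * Real.exp (-(r * g.dist a b)))) :
    HasL2Majorant blk T (fun a b => A * Λ * P a * Real.exp (-((1 - α') * r * g.dist a b))) := by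
  refine hasL2Majorant_mono blk h fun a b => ?_
  have e : Real.exp (-(r * g.dist a b)) =
      Real.exp (-(α' * r * g.dist a b)) * Real.exp (-((1 - α') * r * g.dist a b)) := by
    rw [← Real.exp_add]; congr 1; ring
  rw [e]
  have hE : 0 ≤ Real.exp (-((1 - α') * r * g.dist a b)) := Real.exp_nonneg _
  calc A * P b * (Real.exp (-(α' * r * g.dist a b)) * Real.exp (-((1 - α') * r * g.dist a b)))
      = A * (Real.exp (-(α' * r * g.dist a b)) * P b) * Real.exp (-((1 - α') * r * g.dist a b)) := by ring
    _ ≤ A * (Λ * P a) * Real.exp (-((1 - α') * r * g.dist a b)) :=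
        mul_le_mul_of_nonneg_right (mul_le_mul_of_nonneg_left (htr a b) hA) hE
    _ = _ := by ring

/-- rate monotonicity for a nonnegative prefactor: `e^{−rd} ≤ e^{−ρd}` for `ρ ≤ r`, `d ≥ 0`. [cite: Balaban1984PropagatorsII, (2.52) p.232 (bookkeeping, ours)] -/
theorem hasL2Majorant_rate_mono' (F : g.Site → g.Site → ℝ) {ρ r : ℝ} (hF : ∀ a b, 0 ≤ F a b) (hρr : ρ ≤ r)
    (hdnn : ∀ y y' : g.Site, 0 ≤ g.dist y y') {T : Module.End ℝ (X → ℝ)}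
    (h : HasL2Majorant blk T (fun a b => F a b * Real.exp (-(r * g.dist a b)))) :
    HasL2Majorant blk T (fun a b => F a b * Real.exp (-(ρ * g.dist a b))) :=
  hasL2Majorant_mono blk h fun a b =>
    mul_le_mul_of_nonneg_left (Real.exp_le_exp.mpr (by nlinarith [hdnn a b])) (hF a b)

/-! ## §3  The right entry by the left walk, powers at the output block -/

/-- **THE RIGHT ENTRY BY THE LEFT-ROUTED WALK, IN `L²`, POWERS AT THE OUTPUT BLOCK AS PRINTED.**  Let `Y = Y₀ + MY` (e.g. `Y = G′(U′U)∇*`,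
`Y₀ = G′(U)∇*`, `M = G′(U)V′(A)`, first form of (3.65)), `Y₀ ≺₂ B·P(y)·e^{−δ₀d}` (Theorem 3.1's entry, weight at the OUTPUT block),
`M ≺₂ θ·e^{−δ₀d}`; let the weight move across `e^{−α′δ₀d}` at the cost `Λ` (to the input block) and across `e^{−α″δ₂d}` at the cost `Λ′`
(back to the output block), `δ₁ = (1−α′)δ₀`, `δ₂ = (1−α)δ₁`, and let Lemma 2.1 hold at `(δ₁, α)` with `θc₁(δ₁, α) < 1`.  Then
`Y ≺₂ BΛc₁(1 − θc₁)⁻¹Λ′·P(y)·e^{−(1−α″)δ₂d(y,y′)}` — §1 at the rate `δ₁` between the two transfers of §2 (p. 403 l. 1–9 with p. 398's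
convention; the `L²` reading of pv21's `B6RandomWalkHom.b9_rightEntry_outputWeight_365`).
[cite: Balaban1985BackgroundPropagators, (3.46) p.398 + p.398 (remarks) + (3.64)–(3.65) pp.402–403 + p.403 l.1–9; Balaban1984PropagatorsII, (2.66) p.234 + Lemma 2.1 p.234 + (2.141) p.247] -/
theorem l2Majorant_rightEntry_of_leftFixedPoint [DecidableEq X] (d : ℕ) (δ₀ α' α α'' θ B Λ Λ' : ℝ) (P : g.Site → ℝ)
    (hB : 0 ≤ B) (hΛ : 0 ≤ Λ) (hP : ∀ y, 0 ≤ P y) (hθ : 0 ≤ θ) (hδ₀ : 0 ≤ δ₀) (hα'0 : 0 ≤ α')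
    (hα'1 : α' ≤ 1) (hα1 : α ≤ 1)
    (htri : Triangle254 g) (hrefl : ∀ y : g.Site, g.dist y y = 0) (hsym : ∀ y y' : g.Site, g.dist y y' = g.dist y' y)
    (hdnn : ∀ y y' : g.Site, 0 ≤ g.dist y y')
    (h261 : Ineq261 d g ((1 - α') * δ₀) α) (hsmall : θ * B6.c1 d ((1 - α') * δ₀) α < 1)
    (htr₁ : ∀ a b : g.Site, Real.exp (-(α' * δ₀ * g.dist a b)) * P a ≤ Λ * P b)
    (htr₂ : ∀ a b : g.Site, Real.exp (-(α'' * ((1 - α) * ((1 - α') * δ₀)) * g.dist a b)) * P b ≤ Λ' * P a)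
    {Y Y0 M : Module.End ℝ (X → ℝ)}
    (hY0 : HasL2Majorant blk Y0 (fun a b => B * P a * Real.exp (-(δ₀ * g.dist a b))))
    (hM : HasL2Majorant blk M (fun a b => θ * Real.exp (-(δ₀ * g.dist a b)))) (hfix : Y = Y0 + M * Y) :
    HasL2Majorant blk Y
      (fun a b => B * Λ * B6.c1 d ((1 - α') * δ₀) α * (1 - θ * B6.c1 d ((1 - α') * δ₀) α)⁻¹ * Λ' * P a *
        Real.exp (-((1 - α'') * ((1 - α) * ((1 - α') * δ₀)) * g.dist a b))) := by
  set δ₁ : ℝ := (1 - α') * δ₀ with hδ₁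
  have hδ₁0 : 0 ≤ δ₁ := mul_nonneg (by linarith) hδ₀
  have hδ₁le : δ₁ ≤ δ₀ := by
    have : 0 ≤ α' * δ₀ := mul_nonneg hα'0 hδ₀
    rw [hδ₁]; nlinarith
  have hαδ : 0 ≤ (1 - α) * δ₁ := mul_nonneg (by linarith) hδ₁0
  have h263 : Ineq263 d g δ₁ α := B6RandomWalk.ineq263_of_261 d g δ₁ α htri hδ₁0 hα1 h261
  -- weight to the input block, `M` at the weaker rate
  have hY0' := hasL2Majorant_weight_to_input blk B δ₀ α' Λ P hB htr₁ hY0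
  have hM' : HasL2Majorant blk M (fun a b => θ * Real.exp (-(δ₁ * g.dist a b))) :=
    hasL2Majorant_rate_mono' blk (fun _ _ => θ) (fun _ _ => hθ) hδ₁le hdnn hM
  -- the left walk at the rate δ₁
  have hY := l2Majorant_of_leftFixedPoint_266 blk d δ₁ α θ (B * Λ) P (mul_nonneg hB hΛ) hP hθ hαδ htri hrefl hsym hdnn
    h261 h263 hsmall hY0' hM' hfix
  -- weight back to the output block
  have hq1 : 0 ≤ (1 - θ * B6.c1 d δ₁ α)⁻¹ := inv_nonneg.mpr (by linarith)
  have hA : 0 ≤ B * Λ * B6.c1 d δ₁ α * (1 - θ * B6.c1 d δ₁ α)⁻¹ :=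
    mul_nonneg (mul_nonneg (mul_nonneg hB hΛ) (c1_nonneg d δ₁ α)) hq1
  have := hasL2Majorant_weight_to_output blk (B * Λ * B6.c1 d δ₁ α * (1 - θ * B6.c1 d δ₁ α)⁻¹) ((1 - α) * δ₁) α'' Λ'
    P hA htr₂ hY
  refine hasL2Majorant_mono blk this fun a b => le_of_eq ?_
  ring

end LeftChain

end Literature.MathematicalPhysics.QuantumFieldTheory.Balaban1983to89.B6RandomWalkL2ChainLeft
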